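import Mathlib
import Summits.CriticalPhenomena.Ising3DConformalLimit.Theses.PrecisionLaplacian
import Literature.Probability.LatticeModels.LatticeGreenPotential
import Literature.Probability.LatticeModels.LatticeGreenPositive
import Literature.Probability.LatticeModels.LatticeGreenAsymptotics
import Literature.Probability.LatticeModels.HighDimPointwiseTriviality
import Literature.Probability.LatticeModels.CriticalTwoPointBounds
import Literature.Probability.LatticeModels.CriticalTwoPointLawDimension
import Literature.Probability.LatticeModels.LocalSimonLieb

/-!
# Disproof of `DirectCorrelationStableTail` — findings

Crux `stmt-CriticalPhenomena-4799` = `Summit.CriticalPhenomena.Ising3DConformalLimit.Theses.PrecisionLaplacian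
.DirectCorrelationStableTail` (route `PrecisionLaplacian`, rank 3).  Shape: `H(G) → C(G)` at `G := criticalTwoPoint 3`,
where `H(G)` = "every finite kernel matrix `G_A` is a symmetric potential" (positive definite, inverse a Z-matrix with
nonnegative row sums) and `C(G)` = "the direct correlation function `a = directCorr G` has a stable tail
`a(x)|x|₂^{5-η} - Φ(x̂) → 0`, `0 < η < 1`, `Φ ≥ 0` continuous, `Φ ≢ 0`".

STANDING VERDICT (cycle 2): the crux RESISTS a Lean kill.  `¬(H → C)` needs `H` for the true critical kernel, which is
the open inverse-M conjecture (item 4798 + support 4802); `¬C` alone would need certified control of the tail of the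
infinite-volume precision operator of the critical 3-D Ising model, on which nothing is known in print (no rigorous
Ornstein–Zernike theory at `β_c` in any `d`).  The conformal picture PREDICTS `C` (with `Φ ≡ const ∝ η`, see §7).

What this file proves instead (all `sorry`-free unless marked NEAR-MISS):

* §0 `crux_iff` — the crux is LITERALLY the instance `CruxSchema (criticalTwoPoint 3)` of an abstract schema
  `CruxSchema G := SymmPotentialKernel G → HasStableTail (directCorr G)` (`Iff.rfl`).
* §1 geometry of lattice directions (`tendsto_direction_floor`: lattice directions are dense on `S²`) and what `C`
  forces: `not_hasStableTail_of_tail_vanishing` (if `a(x)|x|^{5-η} → 0` for every `η ∈ (0,1)` then `¬C`), with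
  corollaries `…_of_eventuallyEq_zero` (finite-range precision) and `…_of_abs_le_rpow_neg_five` (`a = O(|x|⁻⁵)`: the
  Gaussian / `η = 0` / finite-variance class); `HasStableTail.tendsto_along_ray` (every lattice ray converges to
  `Φ(x̂₀)`), `HasStableTail.exists_pos_ray` (some ray has a positive limit).
* §2 LOAD-BEARING (Ising input): `not_cruxSchema_delta` — the schema fails at `G = δ₀` (the `β = 0` two-point
  function): `H` holds (`G_A = 1`), `a ≡ 0` off `0`, `C` fails.  So `H` alone proves nothing: ANY proof of the crux
  must use information about `criticalTwoPoint 3` beyond the symmetric-potential hypothesis.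
* §3 LOAD-BEARING (which Ising input): `not_cruxSchema_halfGreen` — the schema fails at `G₀ = latticeGreen/2`, the
  Green kernel of `ℤ³` (massless lattice GFF two-point function): `H` holds (tree: `halfGreen_symmPotential`, DMS
  potential theory), the precision `-Δ` has finite range (tree: `inv_halfGreen_origin_apply_eq_zero`), so `a(x) = 0`
  for `|x| > 1` and `C` fails.  HEADLINE `not_forall_isingEnvelope_cruxSchema`: `G₀` moreover satisfies
  `IsingEnvelope` = every property of `criticalTwoPoint 3` currently PROVED in the tree (nonnegative, even, `→ 0`,
  Simon–Lieb/infrared envelope `c‖x‖⁻² ≤ G ≤ C‖x‖⁻¹`; `isingEnvelope_criticalTwoPoint`), hence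
  `¬ ∀ G, IsingEnvelope G → H G → C G`: the crux cannot follow from `H` plus everything known; the missing input is
  exactly of "`η(3) > 0` + tail regularity" strength (`G₀` is the `η = 0` member of the envelope).  Sharpened by
  `not_forall_isingEnvelope_localSimonLieb_cruxSchema`: `G₀` ALSO satisfies the local Simon–Lieb inequality with the
  true constant `tanh β_c(3)` (harmonicity + tree `one_le_two_mul_mul_tanh_criticalBeta`).  The only further
  statements about `criticalTwoPoint 3` as a function on `ℤ³` proved in the tree are the Messager–Miracle-Solé
  monotonicities (`twoPointFree_add_single_le`, `twoPointFree_le_of_mul_supNorm_le`, via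
  `twoPointPlus_criticalBeta_eq_twoPointFree`); the Green kernel satisfies them too (MMS holds for the Gaussian free
  field by the same reflection argument; concretely, axis-monotonicity and the Turán log-concavity
  `I_n² ≥ I_{n-1}I_{n+1}` of the Bessel heat kernel) — ON PAPER: not formalised for `latticeGreen`, see §7.1.
* §4 JUNK-MODEL check of `H`: `Matrix.inv` of a singular block is `0`, so the Z-sign and row-sum clauses of `H` are
  VACUOUS on singular blocks and positive definiteness is the load-bearing conjunct: the plateau kernel `G ≡ 1`
  (`β = ∞`) satisfies `H` minus `PosDef` with `a ≡ 0` (`not_cruxSchemaNoPD_one`), and violates `PosDef`.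
* §5 STRENGTHENING refuted: two-sided power bounds on `a` do NOT give `C` — a parity-modulated tail
  `a(x) = |x|^{-9/2}(2 + (-1)^{x₀})` obeys `|x|^{-9/2} ≤ a ≤ 3|x|^{-9/2}` but has no stable tail
  (`not_hasStableTail_parityModulated`); so the foreseen split `TailExponent → TailRegularVariation → AngularProfile`
  has content at its second arrow, and the `EtaBoundsTransfer` branch (item 0635) is strictly weaker than `C`.
* §6 scaling: `H` and `C` are invariant under `G ↦ cG`, `c > 0` (`symmPotentialKernel_smul_iff`,
  `hasStableTail_directCorr_smul_iff`), so normalisations (`G(0) = 1`) carry no information; and `H ⇒ |G x| < G 0`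
  (`SymmPotentialKernel.abs_lt_apply_zero`), the only pointwise consequence of `H` at the two-point level we found.
* §7 WHY IT RESISTS / NEAR-MISSES (docstrings, on paper): the converse-Tauberian strengthening
  `H ∧ (G|x|^{1+η} → c) ⇒ C` is false on paper (oscillating step laws inside an isotropic stable domain of attraction,
  Williamson 1968); the amplitude `Φ` is `O(η) ≈ 0.04·A`, so numerics cannot see the `|x|^{-4.96}` tail of `a`
  behind the analytic `|x|^{-5.8}` corrections; Fisher 1964 / Fisher–Burford 1967 / Stell 1968–69 (OZ at criticality)
  are heuristic and assume what `C` asserts.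

STATUS of this revision: §0–§6 machine-checked (rc 0, no `sorry`); §7 is prose + one unproved named statement.

History: cycle 1 (seat `refuter-cdisprove-stmt-CriticalPhenomena-4799-0`) built §0–§3 and landed the potential
theory of `G₀` as Literature (`LatticeGreenPotential.lean` p68919, `LatticeGreenPositive.lean` p68952); its work
file was attached as item evidence only (gate evidence store, not readable from later seats) — this cycle-2 file
RE-ESTABLISHES §0–§3 from the landed Literature and adds §4–§7.  Kit jobs used: none new (j005353, j005306 of the
ideators are cited in §7).
-/

noncomputable section

namespace Summit.CriticalPhenomena.Ising3DConformalLimit.Cruxes.DirectCorrelationStableTail.Disproof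

open Literature.Probability.LatticeModels
open Filter Topology
open scoped Matrix BigOperators

/-! ## §0 The schema `H(G) → C(G)` and the crux as its instance -/

/-- The kernel matrix `G_A = (G (q - p))_{p,q ∈ A}` of a function `G : ℤ³ → ℝ` on a finite `A ⊂ ℤ³`
(the route's inlined `Matrix.of fun (p q : ↥A) => criticalTwoPoint 3 (q.1 - p.1)` with `G` abstracted). -/
abbrev kernelMatrix (G : Site 3 → ℝ) (A : Finset (Site 3)) : Matrix A A ℝ :=
  Matrix.of fun p q : A => G (q.1 - p.1)

/-- `H(G)`: every finite kernel matrix is a SYMMETRIC POTENTIAL — positive definite, inverse a Z-matrix with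
nonnegative row sums (the crux's antecedent with `criticalTwoPoint 3` abstracted to `G`). -/
def SymmPotentialKernel (G : Site 3 → ℝ) : Prop :=
  ∀ A : Finset (Site 3), (kernelMatrix G A).PosDef ∧
    ∀ u v : A, (u ≠ v → (kernelMatrix G A)⁻¹ u v ≤ 0) ∧ 0 ≤ ∑ w, (kernelMatrix G A)⁻¹ u w

/-- The direct correlation function `a(x) = inf_{A ∋ 0,x} -(G_A)⁻¹(0,x)` of a kernel `G` (the route's inlined
object; a genuine monotone limit only under `H`, a bare `Real.iInf` otherwise). -/
def directCorr (G : Site 3 → ℝ) (x : Site 3) : ℝ :=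
  ⨅ A : {A : Finset (Site 3) // (0 : Site 3) ∈ A ∧ x ∈ A},
    -((kernelMatrix G A.1)⁻¹ ⟨0, A.2.1⟩ ⟨x, A.2.2⟩)

/-- Euclidean length `|x|₂ = √(Σ xⱼ²)` of a lattice point (as written in the crux). -/
def euclidNorm (x : Site 3) : ℝ := Real.sqrt (∑ j, ((x j : ℝ)) ^ 2)

/-- The direction `x̂ = x/|x|₂ ∈ ℝ³` of a lattice point (junk `0` at `x = 0`). -/
def direction (x : Site 3) : Fin 3 → ℝ := fun i => (x i : ℝ) / euclidNorm x

/-- The Euclidean unit sphere of `ℝ³` inside `Fin 3 → ℝ` (as written in the crux). -/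
def unitSphere : Set (Fin 3 → ℝ) := {u | ∑ i, u i ^ 2 = 1}

/-- `C(a)`: the function `a : ℤ³ → ℝ` has a STABLE TAIL — `a(x)·|x|₂^{5-η} - Φ(x̂) → 0` cofinitely for some
`η ∈ (0,1)` and some continuous `Φ ≥ 0`, `Φ ≢ 0` on the sphere (the crux's consequent with the direct
correlation function abstracted to `a`). -/
def HasStableTail (a : Site 3 → ℝ) : Prop :=
  ∃ (η : ℝ) (Φ : (Fin 3 → ℝ) → ℝ), 0 < η ∧ η < 1 ∧ ContinuousOn Φ unitSphere ∧
    (∀ u : Fin 3 → ℝ, ∑ i, u i ^ 2 = 1 → 0 ≤ Φ u) ∧ (∃ u : Fin 3 → ℝ, ∑ i, u i ^ 2 = 1 ∧ 0 < Φ u) ∧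
    Tendsto (fun x : Site 3 => a x * euclidNorm x ^ (5 - η) - Φ (direction x)) cofinite (𝓝 0)

/-- The abstract crux schema `H(G) → C(directCorr G)`. -/
def CruxSchema (G : Site 3 → ℝ) : Prop :=
  SymmPotentialKernel G → HasStableTail (directCorr G)

/-- **The crux is literally the instance `G := criticalTwoPoint 3` of the schema** (definitional unfolding only). -/
theorem crux_iff :
    Theses.PrecisionLaplacian.DirectCorrelationStableTail ↔ CruxSchema (criticalTwoPoint 3) :=
  Iff.rfl

/-! ## §1 Lattice directions and what a stable tail forces -/

theorem sum_sq_pos {x : Site 3} (hx : x ≠ 0) : 0 < ∑ j, ((x j : ℝ)) ^ 2 := by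
  obtain ⟨i, hi⟩ := Function.ne_iff.mp hx
  have h1 : ((x i : ℝ)) ^ 2 ≤ ∑ j, ((x j : ℝ)) ^ 2 :=
    Finset.single_le_sum (f := fun j => ((x j : ℝ)) ^ 2) (fun j _ => sq_nonneg _) (Finset.mem_univ i)
  have h2 : (0 : ℝ) < ((x i : ℝ)) ^ 2 := by
    have : (x i : ℝ) ≠ 0 := by exact_mod_cast hi
    positivity
  linarith

theorem euclidNorm_nonneg (x : Site 3) : 0 ≤ euclidNorm x := Real.sqrt_nonneg _

theorem euclidNorm_pos {x : Site 3} (hx : x ≠ 0) : 0 < euclidNorm x :=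
  Real.sqrt_pos.2 (sum_sq_pos hx)

theorem one_le_euclidNorm {x : Site 3} (hx : x ≠ 0) : 1 ≤ euclidNorm x :=
  one_le_sqrt_sum_sq_of_ne_zero hx

/-- The sup norm of `ℤ³` is dominated by the Euclidean length. -/
theorem norm_le_euclidNorm (x : Site 3) : ‖x‖ ≤ euclidNorm x := by
  refine (pi_norm_le_iff_of_nonneg (euclidNorm_nonneg x)).2 fun i => ?_
  rw [Int.norm_eq_abs]
  refine Real.abs_le_sqrt ?_
  exact Finset.single_le_sum (f := fun j => ((x j : ℝ)) ^ 2) (fun j _ => sq_nonneg _) (Finset.mem_univ i)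

/-- `|x|₂ → ∞` along the cofinite filter of `ℤ³`. -/
theorem tendsto_euclidNorm_cofinite : Tendsto euclidNorm (cofinite : Filter (Site 3)) atTop := by
  have h1 : Tendsto (fun x : Site 3 => ‖x‖) cofinite atTop := by
    rw [← Filter.cocompact_eq_cofinite (Site 3)]
    exact tendsto_norm_cocompact_atTop
  exact tendsto_atTop_mono norm_le_euclidNorm h1

theorem euclidNorm_smul {k : ℤ} (hk : 0 ≤ k) (x : Site 3) : euclidNorm (k • x) = k * euclidNorm x := by
  unfold euclidNorm
  have h : ∀ j, ((((k • x) j : ℤ)) : ℝ) ^ 2 = (k : ℝ) ^ 2 * ((x j : ℝ)) ^ 2 := by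
    intro j
    simp only [Pi.smul_apply, smul_eq_mul, Int.cast_mul]
    ring
  simp_rw [h, ← Finset.mul_sum]
  rw [Real.sqrt_mul (sq_nonneg _), Real.sqrt_sq (by exact_mod_cast hk)]

/-- Directions are invariant under positive integer dilations. -/
theorem direction_smul {k : ℤ} (hk : 0 < k) (x : Site 3) : direction (k • x) = direction x := by
  funext i
  unfold direction
  rw [euclidNorm_smul hk.le]
  have hk' : (k : ℝ) ≠ 0 := by exact_mod_cast hk.ne'
  simp only [Pi.smul_apply, smul_eq_mul, Int.cast_mul]
  rw [mul_div_mul_left _ _ hk']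

theorem direction_mem_unitSphere {x : Site 3} (hx : x ≠ 0) : direction x ∈ unitSphere := by
  show ∑ i, (direction x i) ^ 2 = 1
  unfold direction
  simp_rw [div_pow]
  rw [← Finset.sum_div]
  unfold euclidNorm
  rw [Real.sq_sqrt (sum_sq_pos hx).le]
  exact div_self (sum_sq_pos hx).ne'

/-- The ray `n ↦ (n+1)•x₀` through a nonzero lattice point is injective … -/
theorem injective_ray {x : Site 3} (hx : x ≠ 0) :
    Function.Injective fun n : ℕ => (((n + 1 : ℕ) : ℤ)) • x := by
  intro m n h
  obtain ⟨i, hi⟩ := Function.ne_iff.mp hx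
  have h1 := congrFun h i
  simp only [Pi.smul_apply, smul_eq_mul] at h1
  have h2 : ((m + 1 : ℕ) : ℤ) = ((n + 1 : ℕ) : ℤ) := mul_right_cancel₀ hi h1
  omega

/-- … hence tends to the cofinite filter. -/
theorem tendsto_ray_cofinite {x : Site 3} (hx : x ≠ 0) :
    Tendsto (fun n : ℕ => (((n + 1 : ℕ) : ℤ)) • x) atTop cofinite := by
  rw [← Nat.cofinite_eq_atTop]
  exact (injective_ray hx).tendsto_cofinite

/-- **Lattice directions are dense on the sphere**: for `u ∈ S²`, the lattice points `x_N = ⌊N u⌋` (coordinatewise)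
have directions `x̂_N → u`, and are eventually nonzero. -/
theorem tendsto_direction_floor {u : Fin 3 → ℝ} (hu : u ∈ unitSphere) :
    Tendsto (fun N : ℕ => direction (fun i => ⌊(N : ℝ) * u i⌋)) atTop (𝓝 u) ∧
      ∀ᶠ N : ℕ in atTop, (fun i => ⌊(N : ℝ) * u i⌋ : Site 3) ≠ 0 := by
  -- rescaled lattice points `v N = ⌊N u⌋ / N → u`
  set v : ℕ → (Fin 3 → ℝ) := fun N i => (⌊(N : ℝ) * u i⌋ : ℝ) / N with hv
  have hvu : Tendsto v atTop (𝓝 u) := by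
    rw [tendsto_pi_nhds]
    intro i
    have hlow : Tendsto (fun N : ℕ => u i - 1 / (N : ℝ)) atTop (𝓝 (u i)) := by
      simpa using (tendsto_const_nhds (x := u i)).sub (tendsto_one_div_atTop_nhds_zero_nat)
    refine tendsto_of_tendsto_of_tendsto_of_le_of_le' hlow tendsto_const_nhds ?_ ?_
    · filter_upwards [eventually_gt_atTop 0] with N hN
      have hN' : (0 : ℝ) < N := by exact_mod_cast hN
      rw [sub_le_iff_le_add, hv]
      dsimp only
      rw [← add_div, le_div_iff₀ hN']
      have := Int.sub_one_lt_floor ((N : ℝ) * u i)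
      linarith
    · filter_upwards [eventually_gt_atTop 0] with N hN
      have hN' : (0 : ℝ) < N := by exact_mod_cast hN
      rw [hv]
      dsimp only
      rw [div_le_iff₀ hN']
      have := Int.floor_le ((N : ℝ) * u i)
      linarith
  -- their Euclidean lengths tend to `1`
  have hE : Continuous fun w : Fin 3 → ℝ => Real.sqrt (∑ i, w i ^ 2) := by
    refine Real.continuous_sqrt.comp ?_
    exact continuous_finsetSum _ fun i _ => (continuous_apply i).pow 2
  have hEu : Real.sqrt (∑ i, u i ^ 2) = 1 := by
    rw [show ∑ i, u i ^ 2 = 1 from hu, Real.sqrt_one]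
  have hEv : Tendsto (fun N => Real.sqrt (∑ i, v N i ^ 2)) atTop (𝓝 1) := by
    rw [← hEu]
    exact (hE.tendsto u).comp hvu
  -- eventually nonzero
  have hne : ∀ᶠ N : ℕ in atTop, (fun i => ⌊(N : ℝ) * u i⌋ : Site 3) ≠ 0 := by
    filter_upwards [hEv.eventually (lt_mem_nhds (show (1 : ℝ) / 2 < 1 by norm_num)),
      eventually_gt_atTop 0] with N hN hN0 h0
    have hv0 : v N = 0 := by
      funext i
      have := congrFun h0 i
      simp only [Pi.zero_apply] at this
      simp [hv, this]
    rw [hv0] at hN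
    norm_num at hN
  refine ⟨?_, hne⟩
  -- `direction x_N = v N / |v N|`
  have hdir : ∀ᶠ N : ℕ in atTop,
      direction (fun i => ⌊(N : ℝ) * u i⌋) = fun i => v N i / Real.sqrt (∑ j, v N j ^ 2) := by
    filter_upwards [eventually_gt_atTop 0] with N hN
    have hN' : (0 : ℝ) < N := by exact_mod_cast hN
    funext i
    simp only [direction, euclidNorm, hv]
    have hsum : ∑ j, ((⌊(N : ℝ) * u j⌋ : ℝ) / N) ^ 2 = (∑ j, ((⌊(N : ℝ) * u j⌋ : ℤ) : ℝ) ^ 2) / (N : ℝ) ^ 2 := by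
      rw [Finset.sum_div]
      refine Finset.sum_congr rfl fun j _ => ?_
      rw [div_pow]
    rw [hsum, Real.sqrt_div' _ (sq_nonneg _), Real.sqrt_sq hN'.le, div_div_div_cancel_right₀ hN'.ne']
  rw [tendsto_congr' hdir]
  have hlim : Tendsto (fun N => fun i => v N i / Real.sqrt (∑ j, v N j ^ 2)) atTop (𝓝 fun i => u i / 1) := by
    rw [tendsto_pi_nhds]
    intro i
    exact ((tendsto_pi_nhds.1 hvu) i).div hEv one_ne_zero
  simpa using hlim

/-- **No stable tail when the tail vanishes at every admissible rate**: if `a(x)|x|₂^{5-η} → 0` cofinitely for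
every `η ∈ (0,1)`, then `¬ C(a)` — `C` would force `Φ(x̂) → 0` cofinitely, while `Φ` is continuous on the sphere
and positive somewhere, hence `≥ Φ(u)/2 > 0` on a whole lattice ray (dense directions + dilation invariance). -/
theorem not_hasStableTail_of_tail_vanishing {a : Site 3 → ℝ}
    (h : ∀ η : ℝ, 0 < η → η < 1 → Tendsto (fun x => a x * euclidNorm x ^ (5 - η)) cofinite (𝓝 0)) :
    ¬ HasStableTail a := by
  rintro ⟨η, Φ, hη0, hη1, hΦc, -, ⟨u, hu, hΦu⟩, hT⟩
  -- `Φ ∘ direction → 0` cofinitely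
  have h1 : Tendsto (fun x => Φ (direction x)) cofinite (𝓝 0) := by
    have h2 := (h η hη0 hη1).sub hT
    simp only [sub_sub_cancel, sub_zero] at h2
    exact h2
  -- a nonzero lattice point whose direction has `Φ > Φ u / 2`
  obtain ⟨hdir, hne⟩ := tendsto_direction_floor hu
  have hcont : Tendsto (fun N : ℕ => Φ (direction (fun i => ⌊(N : ℝ) * u i⌋))) atTop (𝓝 (Φ u)) := by
    have hw : ContinuousWithinAt Φ unitSphere u := hΦc u hu
    refine hw.tendsto.comp (tendsto_nhdsWithin_iff.2 ⟨hdir, ?_⟩)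
    filter_upwards [hne] with N hN
    exact direction_mem_unitSphere hN
  obtain ⟨N, hN1, hN2⟩ : ∃ N : ℕ, Φ u / 2 < Φ (direction (fun i => ⌊(N : ℝ) * u i⌋)) ∧
      (fun i => ⌊(N : ℝ) * u i⌋ : Site 3) ≠ 0 :=
    ((hcont.eventually (lt_mem_nhds (by linarith))).and hne).exists
  set x₁ : Site 3 := fun i => ⌊(N : ℝ) * u i⌋ with hx₁
  -- the exceptional set `{Φ ∘ direction ≥ Φ u / 2}` is finite …
  have hfin : Set.Finite {x : Site 3 | Φ u / 2 ≤ Φ (direction x)} := by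
    have h2 : ∀ᶠ x in cofinite, Φ (direction x) < Φ u / 2 := h1.eventually (gt_mem_nhds (by linarith))
    rw [Filter.eventually_cofinite] at h2
    refine h2.subset fun x hx => ?_
    simpa [not_lt] using hx
  -- … but contains the whole ray through `x₁`
  have hsub : Set.range (fun n : ℕ => (((n + 1 : ℕ) : ℤ)) • x₁) ⊆ {x : Site 3 | Φ u / 2 ≤ Φ (direction x)} := by
    rintro _ ⟨n, rfl⟩
    show Φ u / 2 ≤ Φ (direction ((((n + 1 : ℕ) : ℤ)) • x₁))
    rw [direction_smul (by positivity) x₁]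
    exact hN1.le
  exact ((Set.infinite_range_of_injective (injective_ray hN2)).mono hsub) hfin

/-- Finite-range (or eventually vanishing) functions have no stable tail. -/
theorem not_hasStableTail_of_eventuallyEq_zero {a : Site 3 → ℝ} (h : a =ᶠ[cofinite] 0) :
    ¬ HasStableTail a :=
  not_hasStableTail_of_tail_vanishing fun η _ _ => by
    refine (tendsto_const_nhds (x := (0 : ℝ))).congr' ?_
    filter_upwards [h] with x hx
    simp [hx]

/-- **The `η = 0` class has no stable tail**: if `|a(x)| ≤ C|x|₂⁻⁵` cofinitely (e.g. a step law with Gaussian-type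
or faster tail), then `¬ C(a)`.  This is the scenario `η(3) = 0` left open by `criticalTwoPoint_bounds`. -/
theorem not_hasStableTail_of_abs_le_rpow_neg_five {a : Site 3 → ℝ} {C : ℝ}
    (h : ∀ᶠ x in cofinite, |a x| ≤ C * euclidNorm x ^ (-(5 : ℝ))) : ¬ HasStableTail a := by
  refine not_hasStableTail_of_tail_vanishing fun η hη0 _ => ?_
  have hpow : Tendsto (fun x : Site 3 => C * euclidNorm x ^ (-η)) cofinite (𝓝 0) := by
    have := (tendsto_rpow_neg_atTop hη0).comp tendsto_euclidNorm_cofinite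
    simpa using this.const_mul C
  refine squeeze_zero_norm' ?_ hpow
  filter_upwards [h, tendsto_euclidNorm_cofinite.eventually (eventually_ge_atTop 1)] with x hx hx1
  have hr : 0 < euclidNorm x := by linarith
  rw [Real.norm_eq_abs, abs_mul, abs_of_nonneg (Real.rpow_nonneg hr.le _)]
  calc |a x| * euclidNorm x ^ (5 - η) ≤ C * euclidNorm x ^ (-(5 : ℝ)) * euclidNorm x ^ (5 - η) :=
        mul_le_mul_of_nonneg_right hx (Real.rpow_nonneg hr.le _)
    _ = C * euclidNorm x ^ (-η) := by
        rw [mul_assoc, ← Real.rpow_add hr]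
        congr 2
        ring

/-- **Every lattice ray converges under `C`**: `a((n+1)x₀)·|(n+1)x₀|₂^{5-η} → Φ(x̂₀)` for every `x₀ ≠ 0`. -/
theorem tendsto_along_ray {a : Site 3 → ℝ} {η : ℝ} {Φ : (Fin 3 → ℝ) → ℝ}
    (hT : Tendsto (fun x : Site 3 => a x * euclidNorm x ^ (5 - η) - Φ (direction x)) cofinite (𝓝 0))
    {x₀ : Site 3} (hx₀ : x₀ ≠ 0) :
    Tendsto (fun n : ℕ => a ((((n + 1 : ℕ) : ℤ)) • x₀) * euclidNorm ((((n + 1 : ℕ) : ℤ)) • x₀) ^ (5 - η))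
      atTop (𝓝 (Φ (direction x₀))) := by
  have h1 := hT.comp (tendsto_ray_cofinite hx₀)
  have h2 : Tendsto (fun n : ℕ => a ((((n + 1 : ℕ) : ℤ)) • x₀) * euclidNorm ((((n + 1 : ℕ) : ℤ)) • x₀) ^ (5 - η)
      - Φ (direction x₀)) atTop (𝓝 0) := by
    refine h1.congr fun n => ?_
    simp only [Function.comp_apply]
    rw [direction_smul (by positivity)]
  have h3 := h2.add (tendsto_const_nhds (x := Φ (direction x₀)))
  simpa using h3

/-- **Ray form of `C`**: a stable tail yields `η ∈ (0,1)` and `Φ` such that EVERY lattice ray converges,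
`a((n+1)x₀)|(n+1)x₀|₂^{5-η} → Φ(x̂₀) ≥ 0`, and SOME ray has a positive limit.  (Turns the crux's conclusion into
one-dimensional renewal statements; used for the modulated counterexample of §5.) -/
theorem HasStableTail.exists_pos_ray {a : Site 3 → ℝ} (h : HasStableTail a) :
    ∃ (η : ℝ) (Φ : (Fin 3 → ℝ) → ℝ), 0 < η ∧ η < 1 ∧
      (∀ x₀ : Site 3, x₀ ≠ 0 → 0 ≤ Φ (direction x₀) ∧
        Tendsto (fun n : ℕ => a ((((n + 1 : ℕ) : ℤ)) • x₀) * euclidNorm ((((n + 1 : ℕ) : ℤ)) • x₀) ^ (5 - η))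
          atTop (𝓝 (Φ (direction x₀)))) ∧
      ∃ x₁ : Site 3, x₁ ≠ 0 ∧ 0 < Φ (direction x₁) := by
  obtain ⟨η, Φ, hη0, hη1, hΦc, hΦnn, ⟨u, hu, hΦu⟩, hT⟩ := h
  refine ⟨η, Φ, hη0, hη1, fun x₀ hx₀ => ⟨hΦnn _ (direction_mem_unitSphere hx₀), tendsto_along_ray hT hx₀⟩, ?_⟩
  obtain ⟨hdir, hne⟩ := tendsto_direction_floor hu
  have hcont : Tendsto (fun N : ℕ => Φ (direction (fun i => ⌊(N : ℝ) * u i⌋))) atTop (𝓝 (Φ u)) := by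
    have hw : ContinuousWithinAt Φ unitSphere u := hΦc u hu
    refine hw.tendsto.comp (tendsto_nhdsWithin_iff.2 ⟨hdir, ?_⟩)
    filter_upwards [hne] with N hN
    exact direction_mem_unitSphere hN
  obtain ⟨N, hN1, hN2⟩ : ∃ N : ℕ, Φ u / 2 < Φ (direction (fun i => ⌊(N : ℝ) * u i⌋)) ∧
      (fun i => ⌊(N : ℝ) * u i⌋ : Site 3) ≠ 0 :=
    ((hcont.eventually (lt_mem_nhds (by linarith))).and hne).exists
  exact ⟨_, hN2, by linarith⟩


/-! ## §2 The schema is false without Ising input: the `β = 0` kernel `δ₀` -/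

/-- The `β = 0` (infinite-temperature) two-point function `δ₀`: `⟨σ₀σ_x⟩_{β=0} = 1_{x=0}`. -/
def delta : Site 3 → ℝ := fun x => if x = 0 then 1 else 0

/-- Every kernel matrix of `δ₀` is the identity. -/
theorem kernelMatrix_delta (A : Finset (Site 3)) : kernelMatrix delta A = 1 := by
  ext p q
  simp only [kernelMatrix, delta, Matrix.of_apply, sub_eq_zero, Matrix.one_apply]
  by_cases h : p = q
  · subst h; simp
  · have h' : ¬ (q : Site 3) = p := fun e => h (Subtype.ext e.symm)
    simp [h, h']

/-- `H(δ₀)` holds: the identity is a symmetric potential. -/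
theorem symmPotentialKernel_delta : SymmPotentialKernel delta := by
  intro A
  rw [kernelMatrix_delta, inv_one]
  refine ⟨Matrix.PosDef.one, fun u v => ⟨fun huv => ?_, ?_⟩⟩
  · rw [Matrix.one_apply_ne huv]
  · simp [Matrix.one_apply]

/-- The direct correlation function of `δ₀` vanishes off the origin. -/
theorem directCorr_delta {x : Site 3} (hx : x ≠ 0) : directCorr delta x = 0 := by
  unfold directCorr
  have h : ∀ A : {A : Finset (Site 3) // (0 : Site 3) ∈ A ∧ x ∈ A},
      -((kernelMatrix delta A.1)⁻¹ ⟨0, A.2.1⟩ ⟨x, A.2.2⟩) = 0 := by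
    intro A
    rw [kernelMatrix_delta, inv_one, Matrix.one_apply_ne (fun e => hx (Subtype.ext_iff.mp e).symm), neg_zero]
  simp only [h]
  haveI : Nonempty {A : Finset (Site 3) // (0 : Site 3) ∈ A ∧ x ∈ A} := ⟨⟨{0, x}, by simp, by simp⟩⟩
  exact ciInf_const

theorem directCorr_delta_eventuallyEq : directCorr delta =ᶠ[cofinite] 0 := by
  have h : ({0}ᶜ : Set (Site 3)) ∈ (cofinite : Filter (Site 3)) := by
    rw [Filter.mem_cofinite, compl_compl]
    exact Set.finite_singleton 0
  filter_upwards [h] with x hx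
  exact directCorr_delta hx

/-- **LOAD-BEARING: `H` alone does not give `C`.**  The schema fails at `G = δ₀`; any proof of the crux must use
properties of `criticalTwoPoint 3` beyond the symmetric-potential hypothesis. -/
theorem not_cruxSchema_delta : ¬ CruxSchema delta := fun h =>
  not_hasStableTail_of_eventuallyEq_zero directCorr_delta_eventuallyEq (h symmPotentialKernel_delta)

theorem not_forall_cruxSchema : ¬ ∀ G : Site 3 → ℝ, CruxSchema G := fun h => not_cruxSchema_delta (h delta)

/-! ## §3 The schema is false on the `η = 0` boundary of the Ising envelope: the Green kernel of `ℤ³` -/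

/-- `G₀ = latticeGreen/2`, the Green kernel of `ℤ³` = two-point function of the massless lattice Gaussian free
field (`(-Δ) G₀ = δ₀`; tree `LatticeGreenPoisson`, `LatticeGreenPotential`). -/
def halfGreen : Site 3 → ℝ := fun x => latticeGreen x / 2

theorem kernelMatrix_halfGreen (A : Finset (Site 3)) :
    kernelMatrix halfGreen A = Matrix.of fun p q : A => latticeGreen (q.1 - p.1) / 2 := rfl

/-- `H(G₀)` holds: every finite restriction of the Green kernel of `ℤ³` is a symmetric potential
(tree theorem `halfGreen_symmPotential`, from DMS Lemma 2.32 and the limit `Λ ↑ ℤ³`). -/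
theorem symmPotentialKernel_halfGreen : SymmPotentialKernel halfGreen := fun A =>
  halfGreen_symmPotential 3 (le_refl 3) A

/-- The unit ball `{0, ±eᵢ}` of `ℤ³`. -/
def unitBall : Finset (Site 3) :=
  insert 0 ((Finset.univ.image fun i : Fin 3 => (Pi.single i 1 : Site 3)) ∪
    Finset.univ.image fun i : Fin 3 => (-Pi.single i 1 : Site 3))

theorem ne_zero_and_not_adj_of_not_mem_unitBall {x : Site 3} (hx : x ∉ unitBall) :
    x ≠ 0 ∧ ¬ (zdGraph 3).Adj 0 x := by
  refine ⟨fun h => hx (by simp [unitBall, h]), fun h => hx ?_⟩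
  rw [zdGraph_adj_iff] at h
  obtain ⟨i, h | h⟩ := h
  · rw [zero_add] at h
    simp [unitBall, h]
  · have h' : x = -Pi.single i 1 := eq_neg_of_add_eq_zero_left h.symm
    simp [unitBall, h']

/-- **Finite-range precision**: the direct correlation function of `G₀` vanishes off the unit ball — under `H(G₀)`
the infimum is over nonnegative numbers, and it is attained (`= 0`) on every `A ⊇ {0, ±eᵢ, x}` by the tree theorem
`inv_halfGreen_origin_apply_eq_zero` (`(-Δ)G₀ = δ₀` at the level of `Matrix.inv`). -/
theorem directCorr_halfGreen_eq_zero {x : Site 3} (hx0 : x ≠ 0) (hxA : ¬ (zdGraph 3).Adj 0 x) :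
    directCorr halfGreen x = 0 := by
  unfold directCorr
  have hnn : ∀ A : {A : Finset (Site 3) // (0 : Site 3) ∈ A ∧ x ∈ A},
      0 ≤ -((kernelMatrix halfGreen A.1)⁻¹ ⟨0, A.2.1⟩ ⟨x, A.2.2⟩) := fun A =>
    neg_nonneg.2 (((symmPotentialKernel_halfGreen A.1).2 _ _).1 (fun e => hx0 (Subtype.ext_iff.mp e).symm))
  let B : Finset (Site 3) := insert x unitBall
  have h0B : (0 : Site 3) ∈ B := by simp [B, unitBall]
  have hxB : x ∈ B := Finset.mem_insert_self _ _
  have he : ∀ i : Fin 3, (Pi.single i 1 : Site 3) ∈ B ∧ (-Pi.single i 1 : Site 3) ∈ B := fun i =>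
    ⟨by simp [B, unitBall], by simp [B, unitBall]⟩
  have hval : -((kernelMatrix halfGreen B)⁻¹ ⟨0, h0B⟩ ⟨x, hxB⟩) = 0 := by
    rw [neg_eq_zero, kernelMatrix_halfGreen]
    exact inv_halfGreen_origin_apply_eq_zero 3 (le_refl 3) h0B he hxB hx0 hxA
  haveI : Nonempty {A : Finset (Site 3) // (0 : Site 3) ∈ A ∧ x ∈ A} := ⟨⟨B, h0B, hxB⟩⟩
  refine le_antisymm ?_ (le_ciInf hnn)
  have hbdd : BddBelow (Set.range fun A : {A : Finset (Site 3) // (0 : Site 3) ∈ A ∧ x ∈ A} =>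
      -((kernelMatrix halfGreen A.1)⁻¹ ⟨0, A.2.1⟩ ⟨x, A.2.2⟩)) := ⟨0, by rintro _ ⟨A, rfl⟩; exact hnn A⟩
  calc (⨅ A : {A : Finset (Site 3) // (0 : Site 3) ∈ A ∧ x ∈ A}, -((kernelMatrix halfGreen A.1)⁻¹ ⟨0, A.2.1⟩ ⟨x, A.2.2⟩))
      ≤ -((kernelMatrix halfGreen B)⁻¹ ⟨0, h0B⟩ ⟨x, hxB⟩) := ciInf_le hbdd ⟨B, h0B, hxB⟩
    _ = 0 := hval

theorem directCorr_halfGreen_eventuallyEq : directCorr halfGreen =ᶠ[cofinite] 0 := by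
  have h : ((↑unitBall : Set (Site 3))ᶜ) ∈ (cofinite : Filter (Site 3)) := by
    rw [Filter.mem_cofinite, compl_compl]
    exact unitBall.finite_toSet
  filter_upwards [h] with x hx
  obtain ⟨hx0, hxA⟩ := ne_zero_and_not_adj_of_not_mem_unitBall hx
  exact directCorr_halfGreen_eq_zero hx0 hxA

/-- **The schema fails at the Green kernel of `ℤ³`.** -/
theorem not_cruxSchema_halfGreen : ¬ CruxSchema halfGreen := fun h =>
  not_hasStableTail_of_eventuallyEq_zero directCorr_halfGreen_eventuallyEq (h symmPotentialKernel_halfGreen)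

/-- `IsingEnvelope G`: everything the tree currently PROVES about `criticalTwoPoint 3` as a function on `ℤ³`
(up to the harmless normalisation `G 0 = 1`, cf. §6): `G ≥ 0` (Griffiths), `G` even, `G → 0` (no long-range order at
`β_c`), and the Simon–Lieb / infrared envelope `c‖x‖⁻² ≤ G x ≤ C‖x‖⁻¹` (`criticalTwoPoint_bounds`, sup norm). -/
def IsingEnvelope (G : Site 3 → ℝ) : Prop :=
  (∀ x, 0 ≤ G x) ∧ (∀ x, G (-x) = G x) ∧ Tendsto G cofinite (𝓝 0) ∧
    ∃ c C : ℝ, 0 < c ∧ ∀ x : Site 3, x ≠ 0 →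
      c * (‖x‖ : ℝ) ^ (-(2 : ℝ)) ≤ G x ∧ G x ≤ C * (‖x‖ : ℝ) ^ (-(1 : ℝ))

/-- The critical kernel lies in the envelope (tree theorems `criticalTwoPoint_nonneg'`, `criticalTwoPoint_neg`,
`criticalTwoPoint_tendsto_zero_cofinite`, `criticalTwoPoint_bounds_holds`). -/
theorem isingEnvelope_criticalTwoPoint : IsingEnvelope (criticalTwoPoint 3) := by
  refine ⟨criticalTwoPoint_nonneg', criticalTwoPoint_neg, criticalTwoPoint_tendsto_zero_cofinite, ?_⟩
  obtain ⟨c, C, hc, h⟩ := criticalTwoPoint_bounds_holds (d := 3) (le_refl 3)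
  refine ⟨c, C, hc, fun x hx => ?_⟩
  obtain ⟨h1, h2⟩ := h x hx
  constructor
  · convert h1 using 4
    norm_num
  · convert h2 using 4
    norm_num

/-- One has `1 ≤ ‖x‖` for a nonzero lattice point (sup norm). -/
theorem one_le_norm_of_ne_zero {x : Site 3} (hx : x ≠ 0) : 1 ≤ ‖x‖ := by
  obtain ⟨i, hi⟩ := Function.ne_iff.mp hx
  have h1 : ‖x i‖ ≤ ‖x‖ := norm_le_pi_norm x i
  have h2 : (1 : ℝ) ≤ ‖x i‖ := by
    rw [Int.norm_eq_abs]
    have : (1 : ℤ) ≤ |x i| := Int.one_le_abs hi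
    exact_mod_cast this
  linarith

/-- `|x|₂ ≤ √3 ‖x‖` on `ℤ³`. -/
theorem euclidNorm_le_sqrt_three_mul_norm (x : Site 3) : euclidNorm x ≤ Real.sqrt 3 * ‖x‖ := by
  unfold euclidNorm
  have h : ∑ j, ((x j : ℝ)) ^ 2 ≤ 3 * ‖x‖ ^ 2 := by
    have h1 : ∀ j, ((x j : ℝ)) ^ 2 ≤ ‖x‖ ^ 2 := by
      intro j
      have h2 : |(x j : ℝ)| ≤ ‖x‖ := by
        have := norm_le_pi_norm x j
        rwa [Int.norm_eq_abs] at this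
      have h3 : 0 ≤ ‖x‖ := norm_nonneg _
      nlinarith [abs_nonneg ((x j : ℝ)), sq_abs ((x j : ℝ))]
    calc ∑ j, ((x j : ℝ)) ^ 2 ≤ ∑ _j : Fin 3, ‖x‖ ^ 2 := Finset.sum_le_sum fun j _ => h1 j
      _ = 3 * ‖x‖ ^ 2 := by simp
  calc Real.sqrt (∑ j, ((x j : ℝ)) ^ 2) ≤ Real.sqrt (3 * ‖x‖ ^ 2) := Real.sqrt_le_sqrt h
    _ = Real.sqrt 3 * ‖x‖ := by rw [Real.sqrt_mul (by norm_num), Real.sqrt_sq (norm_nonneg _)]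

/-- **The Green kernel lies in the Ising envelope**: `G₀ ≥ 0`, even, `→ 0`, and `c‖x‖⁻² ≤ G₀ x ≤ C‖x‖⁻¹` — from
the tree's `latticeGreen_asymptotics` (`G = (2π|x|₂)⁻¹·… + O(|x|₂⁻³)`, Lawler–Limic Thm 4.3.1), strict positivity
`latticeGreen_pos` on the finitely many small sites, and `tendsto_latticeGreen_cofinite`.  `G₀` is the `η = 0`
member of the envelope. -/
theorem isingEnvelope_halfGreen : IsingEnvelope halfGreen := by
  have h3 : (3 : ℕ) ≤ 3 := le_refl 3
  refine ⟨fun x => div_nonneg (latticeGreen_nonneg 3 h3 x) zero_le_two, fun x => by simp [halfGreen, latticeGreen_neg],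
    ?_, ?_⟩
  · show Tendsto (fun x => latticeGreen x / 2) cofinite (𝓝 0)
    simpa using (tendsto_latticeGreen_cofinite 3 h3).div_const 2
  obtain ⟨K, hK⟩ := latticeGreen_asymptotics (d := 3) h3
  -- the constant `κ = Γ(1/2)/(2π^{3/2}) > 0` of the leading term
  set κ : ℝ := Real.Gamma ((3 : ℝ) / 2 - 1) / (2 * Real.pi ^ ((3 : ℝ) / 2)) with hκ
  have hκ0 : 0 < κ := by
    have h1 : 0 < Real.Gamma ((3 : ℝ) / 2 - 1) := Real.Gamma_pos_of_pos (by norm_num)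
    have h2 : 0 < 2 * Real.pi ^ ((3 : ℝ) / 2) := by positivity
    exact div_pos h1 h2
  have hK0 : 0 ≤ K := by
    -- `K ≥ 0` since it dominates an absolute value at `x = e₀` (where `|e₀|₂ = 1`)
    have h := hK (Pi.single 0 1) (by simp)
    have hr : Real.sqrt (∑ i, (((Pi.single (0 : Fin 3) (1 : ℤ) : Site 3) i : ℝ)) ^ 2) = 1 := by
      simp [Pi.single_apply]
    simp only [hr, Real.one_rpow, mul_one] at h
    exact le_trans (abs_nonneg _) h
  -- asymptotic regime: `|x|₂² ≥ R2 := 2K/κ + 1` gives `κ/2 |x|₂⁻¹ ≤ G ≤ (κ + K)|x|₂⁻¹`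
  -- pointwise consequences of the asymptotics, for every `x ≠ 0`
  have hupper : ∀ x : Site 3, x ≠ 0 → latticeGreen x ≤ (κ + K) * euclidNorm x ^ (-(1 : ℝ)) := by
    intro x hx
    have h := hK x hx
    have hr1 : 1 ≤ euclidNorm x := one_le_euclidNorm hx
    have hr0 : 0 < euclidNorm x := by linarith
    rw [abs_le] at h
    have e1 : euclidNorm x ^ (2 - (3 : ℝ)) = euclidNorm x ^ (-(1 : ℝ)) := by norm_num
    have e2 : euclidNorm x ^ (-(3 : ℝ)) ≤ euclidNorm x ^ (-(1 : ℝ)) :=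
      Real.rpow_le_rpow_of_exponent_le hr1 (by norm_num)
    have h2 := h.2
    change latticeGreen x - κ * euclidNorm x ^ (2 - (3 : ℝ)) ≤ K * euclidNorm x ^ (-(3 : ℝ)) at h2
    rw [e1] at h2
    have : K * euclidNorm x ^ (-(3 : ℝ)) ≤ K * euclidNorm x ^ (-(1 : ℝ)) := mul_le_mul_of_nonneg_left e2 hK0
    linarith
  have hlower : ∀ x : Site 3, x ≠ 0 → κ * euclidNorm x ^ (-(1 : ℝ)) - K * euclidNorm x ^ (-(3 : ℝ)) ≤ latticeGreen x := by
    intro x hx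
    have h := hK x hx
    rw [abs_le] at h
    have h1 := h.1
    change -(K * euclidNorm x ^ (-(3 : ℝ))) ≤ latticeGreen x - κ * euclidNorm x ^ (2 - (3 : ℝ)) at h1
    have e1 : euclidNorm x ^ (2 - (3 : ℝ)) = euclidNorm x ^ (-(1 : ℝ)) := by norm_num
    rw [e1] at h1
    linarith
  -- small sites: a finite box, on which `G₀ > 0` has a positive minimum
  set R : ℝ := Real.sqrt (2 * K / κ) with hR
  set N : ℕ := ⌈R⌉₊ with hN
  set box : Finset (Site 3) := Finset.Icc (fun _ : Fin 3 => -(N : ℤ)) (fun _ => (N : ℤ)) with hbox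
  set S : Finset (Site 3) := box.filter (fun x => x ≠ 0) with hS
  have hSpos : ∀ x ∈ S, 0 < halfGreen x := fun x _ => div_pos (latticeGreen_pos 3 h3 x) two_pos
  set c₁ : ℝ := if hS' : S.Nonempty then S.inf' hS' halfGreen else 1 with hc₁
  have hc₁0 : 0 < c₁ := by
    rw [hc₁]
    split_ifs with hS'
    · exact (Finset.lt_inf'_iff hS').2 hSpos
    · exact one_pos
  have hc₁le : ∀ x ∈ S, c₁ ≤ halfGreen x := by
    intro x hx
    rw [hc₁, dif_pos ⟨x, hx⟩]
    exact Finset.inf'_le _ hx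
  have hmemS : ∀ x : Site 3, x ≠ 0 → euclidNorm x ^ 2 < 2 * K / κ → x ∈ S := by
    intro x hx hsmall
    have hr : euclidNorm x < R := (Real.lt_sqrt (euclidNorm_nonneg x)).2 hsmall
    have hRN : R ≤ N := Nat.le_ceil R
    have hcoord : ∀ i, |(x i : ℝ)| ≤ euclidNorm x := fun i =>
      Real.abs_le_sqrt (Finset.single_le_sum (f := fun j => ((x j : ℝ)) ^ 2) (fun j _ => sq_nonneg _)
        (Finset.mem_univ i))
    rw [hS, Finset.mem_filter]
    refine ⟨?_, hx⟩
    rw [hbox, Finset.mem_Icc, Pi.le_def, Pi.le_def]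
    refine ⟨fun i => ?_, fun i => ?_⟩
    · have h1 : |(x i : ℝ)| ≤ N := by linarith [hcoord i]
      have h2 : (-(N : ℝ)) ≤ (x i : ℝ) := (abs_le.mp h1).1
      exact_mod_cast h2
    · have h1 : |(x i : ℝ)| ≤ N := by linarith [hcoord i]
      have h2 : (x i : ℝ) ≤ N := (abs_le.mp h1).2
      exact_mod_cast h2
  -- far sites: the asymptotics give `κ/(4√3) ‖x‖⁻² ≤ G₀`
  have hs3 : 0 < Real.sqrt 3 := Real.sqrt_pos.2 (by norm_num)
  have hfar : ∀ x : Site 3, x ≠ 0 → 2 * K / κ ≤ euclidNorm x ^ 2 →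
      κ / (4 * Real.sqrt 3) * ‖x‖ ^ (-(2 : ℝ)) ≤ halfGreen x := by
    intro x hx hbig
    have hr1 := one_le_euclidNorm hx
    have hr0 : 0 < euclidNorm x := by linarith
    have hn1 := one_le_norm_of_ne_zero hx
    have hn0 : 0 < ‖x‖ := by linarith
    have h1 := hlower x hx
    have hr3 : euclidNorm x ^ (-(3 : ℝ)) = euclidNorm x ^ (-(1 : ℝ)) * (euclidNorm x ^ 2)⁻¹ := by
      rw [show (-(3 : ℝ)) = -(1 : ℝ) + -(2 : ℝ) by norm_num, Real.rpow_add hr0, Real.rpow_neg hr0.le (2 : ℝ),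
        Real.rpow_two]
    have h2 : K * euclidNorm x ^ (-(3 : ℝ)) ≤ κ / 2 * euclidNorm x ^ (-(1 : ℝ)) := by
      rw [hr3]
      have hpos : 0 < euclidNorm x ^ (-(1 : ℝ)) := Real.rpow_pos_of_pos hr0 _
      have hsq : 0 < euclidNorm x ^ 2 := by positivity
      have h3 : K * (euclidNorm x ^ 2)⁻¹ ≤ κ / 2 := by
        rw [mul_inv_le_iff₀ hsq]
        have := (div_le_iff₀ hκ0).mp hbig
        nlinarith
      calc K * (euclidNorm x ^ (-(1 : ℝ)) * (euclidNorm x ^ 2)⁻¹)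
          = (K * (euclidNorm x ^ 2)⁻¹) * euclidNorm x ^ (-(1 : ℝ)) := by ring
        _ ≤ κ / 2 * euclidNorm x ^ (-(1 : ℝ)) := mul_le_mul_of_nonneg_right h3 hpos.le
    have h4 : κ / 2 * euclidNorm x ^ (-(1 : ℝ)) ≤ latticeGreen x := by linarith
    have h5 : ‖x‖ ^ (-(2 : ℝ)) / Real.sqrt 3 ≤ euclidNorm x ^ (-(1 : ℝ)) := by
      have h6 : euclidNorm x ≤ Real.sqrt 3 * ‖x‖ ^ 2 := by
        calc euclidNorm x ≤ Real.sqrt 3 * ‖x‖ := euclidNorm_le_sqrt_three_mul_norm x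
          _ ≤ Real.sqrt 3 * ‖x‖ ^ 2 := by
            apply mul_le_mul_of_nonneg_left _ hs3.le
            nlinarith
      have h7 : 1 / (Real.sqrt 3 * ‖x‖ ^ 2) ≤ 1 / euclidNorm x := one_div_le_one_div_of_le hr0 h6
      have e1 : ‖x‖ ^ (-(2 : ℝ)) / Real.sqrt 3 = 1 / (Real.sqrt 3 * ‖x‖ ^ 2) := by
        rw [Real.rpow_neg hn0.le, Real.rpow_two]
        field_simp
      have e2 : euclidNorm x ^ (-(1 : ℝ)) = 1 / euclidNorm x := by
        rw [Real.rpow_neg hr0.le, Real.rpow_one, one_div]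
      rw [e1, e2]
      exact h7
    have h8 : κ / (4 * Real.sqrt 3) * ‖x‖ ^ (-(2 : ℝ)) = κ / 4 * (‖x‖ ^ (-(2 : ℝ)) / Real.sqrt 3) := by
      field_simp
    rw [h8]
    calc κ / 4 * (‖x‖ ^ (-(2 : ℝ)) / Real.sqrt 3) ≤ κ / 4 * euclidNorm x ^ (-(1 : ℝ)) :=
        mul_le_mul_of_nonneg_left h5 (by positivity)
      _ ≤ halfGreen x := by
        show _ ≤ latticeGreen x / 2
        linarith
  -- the constants
  set c : ℝ := min c₁ (κ / (4 * Real.sqrt 3)) with hc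
  have hc0 : 0 < c := lt_min hc₁0 (by positivity)
  refine ⟨c, (κ + K) / 2, hc0, fun x hx => ⟨?_, ?_⟩⟩
  · -- lower bound
    have hn1 := one_le_norm_of_ne_zero hx
    have hn0 : 0 < ‖x‖ := by linarith
    have hpow1 : ‖x‖ ^ (-(2 : ℝ)) ≤ 1 := Real.rpow_le_one_of_one_le_of_nonpos hn1 (by norm_num)
    have hpow0 : 0 ≤ ‖x‖ ^ (-(2 : ℝ)) := Real.rpow_nonneg hn0.le _
    by_cases hbig : 2 * K / κ ≤ euclidNorm x ^ 2
    · calc c * ‖x‖ ^ (-(2 : ℝ)) ≤ κ / (4 * Real.sqrt 3) * ‖x‖ ^ (-(2 : ℝ)) :=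
          mul_le_mul_of_nonneg_right (min_le_right _ _) hpow0
        _ ≤ halfGreen x := hfar x hx hbig
    · push Not at hbig
      have hxS := hmemS x hx hbig
      calc c * ‖x‖ ^ (-(2 : ℝ)) ≤ c₁ * ‖x‖ ^ (-(2 : ℝ)) := mul_le_mul_of_nonneg_right (min_le_left _ _) hpow0
        _ ≤ c₁ * 1 := mul_le_mul_of_nonneg_left hpow1 hc₁0.le
        _ = c₁ := mul_one _
        _ ≤ halfGreen x := hc₁le x hxS
  · -- upper bound
    have hr1 : 1 ≤ euclidNorm x := one_le_euclidNorm hx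
    have hn1 : 1 ≤ ‖x‖ := one_le_norm_of_ne_zero hx
    have h1 : euclidNorm x ^ (-(1 : ℝ)) ≤ ‖x‖ ^ (-(1 : ℝ)) := by
      rw [Real.rpow_neg (by linarith), Real.rpow_neg (by linarith), Real.rpow_one, Real.rpow_one]
      exact inv_anti₀ (by linarith) (norm_le_euclidNorm x)
    have hκK : 0 ≤ κ + K := by linarith
    calc halfGreen x = latticeGreen x / 2 := rfl
      _ ≤ (κ + K) * euclidNorm x ^ (-(1 : ℝ)) / 2 := by linarith [hupper x hx]
      _ ≤ (κ + K) * ‖x‖ ^ (-(1 : ℝ)) / 2 := by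
          have := mul_le_mul_of_nonneg_left h1 hκK
          linarith
      _ = (κ + K) / 2 * ‖x‖ ^ (-(1 : ℝ)) := by ring


/-- **HEADLINE (load-bearing analysis).**  The crux schema is false on the Ising envelope: there is a kernel with
every property of `criticalTwoPoint 3` proved in the tree AND the symmetric-potential property `H`, whose direct
correlation function has no stable tail (witness `G₀ = latticeGreen/2`, the `η = 0` corner).  Consequently any proof
of `DirectCorrelationStableTail` must use an input on the critical kernel that EXCLUDES the lattice Green kernel —
in substance `η(3) > 0` together with tail regularity of the precision row; neither `H` (= IM, item 4798/4802) nor the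
Simon–Lieb/infrared envelope nor their conjunction suffices. -/
theorem not_forall_isingEnvelope_cruxSchema :
    ¬ ∀ G : Site 3 → ℝ, IsingEnvelope G → CruxSchema G := fun h =>
  not_cruxSchema_halfGreen (h halfGreen isingEnvelope_halfGreen)

/-- The same statement with `H` unfolded: envelope + symmetric potential ⇏ stable tail. -/
theorem not_forall_isingEnvelope_symmPotential_hasStableTail :
    ¬ ∀ G : Site 3 → ℝ, IsingEnvelope G → SymmPotentialKernel G → HasStableTail (directCorr G) :=
  not_forall_isingEnvelope_cruxSchema

/-- The one further inequality the tree proves about the critical kernel as a function on `ℤ³`: the LOCAL SIMON–LIEB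
inequality at `β_c(3)`, `G(z) ≤ tanh β_c(3) · Σᵢ (G(z-eᵢ) + G(z+eᵢ))` for `z ≠ 0`
(`criticalTwoPoint_le_tanh_mul_sum_nbrs`), stated as a property of a kernel with the TRUE constant `tanh β_c(3)`. -/
def LocalSimonLieb (G : Site 3 → ℝ) : Prop :=
  ∀ z : Site 3, z ≠ 0 →
    G z ≤ Real.tanh (criticalBeta 3) * ∑ i : Fin 3, (G (z - Pi.single i 1) + G (z + Pi.single i 1))

theorem localSimonLieb_criticalTwoPoint : LocalSimonLieb (criticalTwoPoint 3) := fun _ hz =>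
  criticalTwoPoint_le_tanh_mul_sum_nbrs (by norm_num) hz

/-- **The Green kernel also satisfies the local Simon–Lieb inequality with the Ising constant**: `G₀` is harmonic
off the origin, `G₀(z) = (1/6) Σ_{y∼z} G₀(y)` (`latticeLaplacianZd_latticeGreen_of_ne_zero`), and
`6 tanh β_c(3) ≥ 1` is the tree theorem `one_le_two_mul_mul_tanh_criticalBeta` (Duminil-Copin–Tassion 2016:
`φ_{β_c}({0}) ≥ 1`). -/
theorem localSimonLieb_halfGreen : LocalSimonLieb halfGreen := by
  intro z hz
  have hharm := latticeLaplacianZd_latticeGreen_of_ne_zero (d := 3) (le_refl 3) hz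
  rw [latticeLaplacianZd_def] at hharm
  have hsum : ∑ i : Fin 3, (halfGreen (z - Pi.single i 1) + halfGreen (z + Pi.single i 1)) = 6 * halfGreen z := by
    have h1 : ∑ i : Fin 3, (halfGreen (z - Pi.single i 1) + halfGreen (z + Pi.single i 1)) =
        (∑ i : Fin 3, (latticeGreen (z + Pi.single i 1) + latticeGreen (z - Pi.single i 1))) / 2 := by
      rw [Finset.sum_div]
      refine Finset.sum_congr rfl fun i _ => ?_
      simp only [halfGreen]
      ring
    rw [h1]
    simp only [halfGreen]
    have h2 : ∑ i : Fin 3, (latticeGreen (z + Pi.single i 1) + latticeGreen (z - Pi.single i 1)) =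
        2 * (3 : ℕ) * latticeGreen z := by linarith
    rw [h2]
    push_cast
    ring
  rw [hsum]
  have ht : 1 ≤ 2 * ((3 : ℕ) : ℝ) * Real.tanh (criticalBeta 3) := by
    exact_mod_cast one_le_two_mul_mul_tanh_criticalBeta (d := 3) (by norm_num)
  have hG : 0 ≤ halfGreen z := div_nonneg (latticeGreen_nonneg 3 (le_refl 3) z) zero_le_two
  push_cast at ht
  nlinarith

/-- **HEADLINE, sharpened**: even with the local Simon–Lieb inequality (true Ising constant) added to the envelope,
`H` does not give `C` — the witness is still `G₀ = latticeGreen/2`.  With this, `G₀` satisfies every statement about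
`criticalTwoPoint 3` as a function on `ℤ³` that the tree proves, up to the scale-invariant normalisation of §6 and
with the exception of the Messager–Miracle-Solé monotonicities, which `G₀` satisfies on paper (GFF) but which are
not formalised for `latticeGreen`. -/
theorem not_forall_isingEnvelope_localSimonLieb_cruxSchema :
    ¬ ∀ G : Site 3 → ℝ, IsingEnvelope G → LocalSimonLieb G → CruxSchema G := fun h =>
  not_cruxSchema_halfGreen (h halfGreen isingEnvelope_halfGreen localSimonLieb_halfGreen)

/-! ## §4 Junk-model check: positive definiteness is the load-bearing conjunct of `H`

`Matrix.inv` of a singular matrix is `0` (Mathlib's `nonsing_inv`), so on a singular block the clauses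
"`(G_A)⁻¹ u v ≤ 0` for `u ≠ v`" and "`0 ≤ Σ_w (G_A)⁻¹ u w`" hold trivially.  The plateau kernel `G ≡ 1`
(`β = ∞`, frozen plus state) therefore satisfies `H` minus positive definiteness, with direct correlation `≡ 0`
off the origin — and of course no stable tail — while it violates positive definiteness.  Moral for the support item
`InverseMCriticalKernel` (4802): its conclusion must deliver genuine positive definiteness of every `G_A` in infinite
volume (finite energy), not just the sign pattern, or the crux's `a` silently becomes `Real.iInf` junk. -/

/-- `H` with the positive-definiteness conjunct dropped. -/
def SymmPotentialKernelNoPD (G : Site 3 → ℝ) : Prop :=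
  ∀ A : Finset (Site 3), ∀ u v : A, (u ≠ v → (kernelMatrix G A)⁻¹ u v ≤ 0) ∧ 0 ≤ ∑ w, (kernelMatrix G A)⁻¹ u w

/-- The plateau kernel `G ≡ 1`. -/
def plateau : Site 3 → ℝ := fun _ => 1

theorem det_kernelMatrix_plateau_eq_zero {A : Finset (Site 3)} {u v : A} (huv : u ≠ v) :
    (kernelMatrix plateau A).det = 0 :=
  Matrix.det_zero_of_row_eq huv (funext fun _ => rfl)

theorem inv_kernelMatrix_plateau_eq_zero {A : Finset (Site 3)} {u v : A} (huv : u ≠ v) :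
    (kernelMatrix plateau A)⁻¹ = 0 :=
  Matrix.nonsing_inv_apply_not_isUnit _ (by rw [det_kernelMatrix_plateau_eq_zero huv]; exact not_isUnit_zero)

/-- `G ≡ 1` satisfies `H` minus positive definiteness (vacuously on every block with two sites). -/
theorem symmPotentialKernelNoPD_plateau : SymmPotentialKernelNoPD plateau := by
  intro A u v
  by_cases hA : ∃ v' : A, v' ≠ u
  · obtain ⟨v', hv'⟩ := hA
    simp [inv_kernelMatrix_plateau_eq_zero hv']
  · push Not at hA
    have hone : kernelMatrix plateau A = 1 := by
      ext i j
      rw [(hA i).trans (hA j).symm, Matrix.one_apply_eq]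
      rfl
    rw [hone, inv_one]
    refine ⟨fun huv => (huv ((hA u).trans (hA v).symm)).elim, ?_⟩
    simp [Matrix.one_apply]

/-- … but violates positive definiteness (already on `A = {0, e₀}`). -/
theorem not_symmPotentialKernel_plateau : ¬ SymmPotentialKernel plateau := by
  intro h
  have h0 : (0 : Site 3) ∈ ({0, Pi.single 0 1} : Finset (Site 3)) := by simp
  have h1 : (Pi.single 0 1 : Site 3) ∈ ({0, Pi.single 0 1} : Finset (Site 3)) := by simp
  have hne : (⟨0, h0⟩ : ({0, Pi.single 0 1} : Finset (Site 3))) ≠ ⟨Pi.single 0 1, h1⟩ := by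
    intro e
    have := congrFun (Subtype.ext_iff.mp e) 0
    simp at this
  have hdet := det_kernelMatrix_plateau_eq_zero hne
  exact absurd hdet (h {0, Pi.single 0 1}).1.det_pos.ne'

/-- Its direct correlation function vanishes off the origin (every admissible block is singular). -/
theorem directCorr_plateau {x : Site 3} (hx : x ≠ 0) : directCorr plateau x = 0 := by
  unfold directCorr
  have h : ∀ A : {A : Finset (Site 3) // (0 : Site 3) ∈ A ∧ x ∈ A},
      -((kernelMatrix plateau A.1)⁻¹ ⟨0, A.2.1⟩ ⟨x, A.2.2⟩) = 0 := by
    intro A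
    have hne : (⟨0, A.2.1⟩ : A.1) ≠ ⟨x, A.2.2⟩ := fun e => hx (Subtype.ext_iff.mp e).symm
    rw [inv_kernelMatrix_plateau_eq_zero hne]
    simp
  simp only [h]
  haveI : Nonempty {A : Finset (Site 3) // (0 : Site 3) ∈ A ∧ x ∈ A} := ⟨⟨{0, x}, by simp, by simp⟩⟩
  exact ciInf_const

/-- **`H` without positive definiteness does not give `C`** (witness `G ≡ 1`). -/
theorem not_noPD_imp_hasStableTail_plateau :
    ¬ (SymmPotentialKernelNoPD plateau → HasStableTail (directCorr plateau)) := fun h => by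
  refine not_hasStableTail_of_eventuallyEq_zero ?_ (h symmPotentialKernelNoPD_plateau)
  have hc : ({0}ᶜ : Set (Site 3)) ∈ (cofinite : Filter (Site 3)) := by
    rw [Filter.mem_cofinite, compl_compl]
    exact Set.finite_singleton 0
  filter_upwards [hc] with x hx
  exact directCorr_plateau hx


/-! ## §5 Two-sided power bounds do not give a stable tail: a parity-modulated kernel

The route foresees the split `TailExponent (two-sided c|x|^{-(5-η)} ≤ a ≤ C|x|^{-(5-η)}) → TailRegularVariation →
AngularProfile`, and the dividend `EtaBoundsTransfer` (item 4805) consumes only the two-sided bounds.  The following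
explicit function shows the second arrow has content: two-sided bounds of the right exponent, yet NO stable tail,
because of a bounded oscillation (here a sublattice/parity modulation; a log-periodic modulation `2 + sin(log|x|)` —
the scenario of card `rp-cannot-fix-the-scale-log-periodic` — behaves identically along every ray). -/

/-- `a(x) = |x|₂^{-9/2}·(2 + (-1)^{|x₀|})`. -/
def parityModulated : Site 3 → ℝ := fun x => euclidNorm x ^ (-(9 / 2 : ℝ)) * (2 + (-1) ^ (x 0).natAbs)

/-- Two-sided bounds with exponent `5 - η₀`, `η₀ = 1/2`. -/
theorem parityModulated_bounds {x : Site 3} (hx : x ≠ 0) :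
    euclidNorm x ^ (-(9 / 2 : ℝ)) ≤ parityModulated x ∧
      parityModulated x ≤ 3 * euclidNorm x ^ (-(9 / 2 : ℝ)) := by
  have hp : 0 < euclidNorm x ^ (-(9 / 2 : ℝ)) := Real.rpow_pos_of_pos (euclidNorm_pos hx) _
  have hs : (-1 : ℝ) ^ (x 0).natAbs = 1 ∨ (-1 : ℝ) ^ (x 0).natAbs = -1 := neg_one_pow_eq_or ℝ _
  unfold parityModulated
  rcases hs with h | h <;> rw [h] <;> constructor <;> nlinarith

theorem parityModulated_nonneg (x : Site 3) : 0 ≤ parityModulated x := by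
  have hp : 0 ≤ euclidNorm x ^ (-(9 / 2 : ℝ)) := Real.rpow_nonneg (euclidNorm_nonneg x) _
  have hs : (-1 : ℝ) ^ (x 0).natAbs = 1 ∨ (-1 : ℝ) ^ (x 0).natAbs = -1 := neg_one_pow_eq_or ℝ _
  unfold parityModulated
  rcases hs with h | h <;> rw [h] <;> nlinarith

/-- The sequence `2 + (-1)^{n+1}` does not converge. -/
theorem not_tendsto_two_add_neg_one_pow {L : ℝ} :
    ¬ Tendsto (fun n : ℕ => (2 : ℝ) + (-1) ^ (n + 1)) atTop (𝓝 L) := by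
  intro h
  obtain ⟨N, hN⟩ := Metric.tendsto_atTop.1 h 1 one_pos
  have h1 := hN (2 * N) (by omega)
  have h2 := hN (2 * N + 1) (by omega)
  have e1 : ((-1 : ℝ)) ^ (2 * N + 1) = -1 := by rw [pow_succ, pow_mul]; norm_num
  have e2 : ((-1 : ℝ)) ^ (2 * N + 1 + 1) = 1 := by rw [pow_succ, e1]; norm_num
  simp only [e1, e2, Real.dist_eq] at h1 h2
  rw [abs_lt] at h1 h2
  norm_num at h1 h2
  linarith [h1.1, h1.2, h2.1, h2.2]

theorem euclidNorm_ray (x₁ : Site 3) (n : ℕ) :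
    euclidNorm ((((n + 1 : ℕ) : ℤ)) • x₁) = ((n + 1 : ℕ) : ℝ) * euclidNorm x₁ := by
  rw [euclidNorm_smul (by positivity)]
  push_cast
  ring

theorem tendsto_euclidNorm_ray {x₁ : Site 3} (hx₁ : x₁ ≠ 0) :
    Tendsto (fun n : ℕ => euclidNorm ((((n + 1 : ℕ) : ℤ)) • x₁)) atTop atTop := by
  simp_rw [euclidNorm_ray]
  exact (tendsto_natCast_atTop_atTop.comp (tendsto_add_atTop_nat 1)).atTop_mul_const (euclidNorm_pos hx₁)

theorem ray_ne_zero {x₁ : Site 3} (hx₁ : x₁ ≠ 0) (n : ℕ) : (((n + 1 : ℕ) : ℤ)) • x₁ ≠ 0 :=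
  smul_ne_zero (by omega) hx₁

/-- **Two-sided bounds ⇏ `C`**: the parity-modulated function has no stable tail.  Along the ray through a point
`x₁` with `Φ(x̂₁) > 0` the rescaled values are `((n+1)|x₁|)^{1/2-η}·bₙ` with `bₙ ∈ {1,3}`: divergent if `η < 1/2`,
null if `η > 1/2` (contradicting `Φ(x̂₁) > 0`), and for `η = 1/2` the ray through `e₀` gives `2 + (-1)^{n+1}`. -/
theorem not_hasStableTail_parityModulated : ¬ HasStableTail parityModulated := by
  intro h
  obtain ⟨η, Φ, hη0, hη1, hray, x₁, hx₁, hpos⟩ := h.exists_pos_ray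
  obtain ⟨-, h₁⟩ := hray x₁ hx₁
  have hρ := tendsto_euclidNorm_ray hx₁
  rcases lt_trichotomy η (1 / 2) with hlt | heq | hgt
  · -- `η < 1/2`: the ray sequence diverges
    have hdiv : Tendsto (fun n : ℕ => parityModulated ((((n + 1 : ℕ) : ℤ)) • x₁) *
        euclidNorm ((((n + 1 : ℕ) : ℤ)) • x₁) ^ (5 - η)) atTop atTop := by
      have hpow := (tendsto_rpow_atTop (show 0 < 1 / 2 - η by linarith)).comp hρ
      refine tendsto_atTop_mono (fun n => ?_) hpow
      simp only [Function.comp_apply]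
      have hρ0 : 0 < euclidNorm ((((n + 1 : ℕ) : ℤ)) • x₁) := euclidNorm_pos (ray_ne_zero hx₁ n)
      have hb := (parityModulated_bounds (ray_ne_zero hx₁ n)).1
      calc euclidNorm ((((n + 1 : ℕ) : ℤ)) • x₁) ^ (1 / 2 - η)
          = euclidNorm ((((n + 1 : ℕ) : ℤ)) • x₁) ^ (-(9 / 2 : ℝ)) *
              euclidNorm ((((n + 1 : ℕ) : ℤ)) • x₁) ^ (5 - η) := by
            rw [← Real.rpow_add hρ0]
            congr 1
            ring
        _ ≤ parityModulated ((((n + 1 : ℕ) : ℤ)) • x₁) * euclidNorm ((((n + 1 : ℕ) : ℤ)) • x₁) ^ (5 - η) :=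
            mul_le_mul_of_nonneg_right hb (Real.rpow_nonneg hρ0.le _)
    exact (hdiv.not_tendsto (disjoint_nhds_atTop _).symm) h₁
  · -- `η = 1/2`: the ray through `e₀` oscillates
    subst heq
    have he₀ : (Pi.single 0 1 : Site 3) ≠ 0 := by
      intro e
      have := congrFun e 0
      simp at this
    obtain ⟨-, h₀⟩ := hray (Pi.single 0 1) he₀
    have hseq : ∀ n : ℕ, parityModulated ((((n + 1 : ℕ) : ℤ)) • (Pi.single 0 1 : Site 3)) *
        euclidNorm ((((n + 1 : ℕ) : ℤ)) • (Pi.single 0 1 : Site 3)) ^ (5 - 1 / 2 : ℝ) = 2 + (-1) ^ (n + 1) := by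
      intro n
      have hE : euclidNorm ((((n + 1 : ℕ) : ℤ)) • (Pi.single 0 1 : Site 3)) = ((n + 1 : ℕ) : ℝ) := by
        rw [euclidNorm_ray]
        have : euclidNorm (Pi.single 0 1 : Site 3) = 1 := by simp [euclidNorm, Pi.single_apply]
        rw [this, mul_one]
      have h0 : ((((n + 1 : ℕ) : ℤ)) • (Pi.single 0 1 : Site 3)) 0 = ((n + 1 : ℕ) : ℤ) := by simp
      unfold parityModulated
      rw [hE, h0, Int.natAbs_natCast]
      have hp : (0 : ℝ) < ((n + 1 : ℕ) : ℝ) := by positivity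
      rw [mul_comm, ← mul_assoc, ← Real.rpow_add hp]
      norm_num
    exact not_tendsto_two_add_neg_one_pow (h₀.congr hseq)
  · -- `η > 1/2`: the ray sequence is null, contradicting `Φ(x̂₁) > 0`
    have hlim0 : Tendsto (fun n : ℕ => parityModulated ((((n + 1 : ℕ) : ℤ)) • x₁) *
        euclidNorm ((((n + 1 : ℕ) : ℤ)) • x₁) ^ (5 - η)) atTop (𝓝 0) := by
      have hpow := (tendsto_rpow_neg_atTop (show 0 < η - 1 / 2 by linarith)).comp hρ
      refine squeeze_zero_norm (a := fun n : ℕ => 3 * euclidNorm ((((n + 1 : ℕ) : ℤ)) • x₁) ^ (-(η - 1 / 2)))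
        (fun n => ?_) (by simpa using hpow.const_mul 3)
      have hρ0 : 0 < euclidNorm ((((n + 1 : ℕ) : ℤ)) • x₁) := euclidNorm_pos (ray_ne_zero hx₁ n)
      have hb := (parityModulated_bounds (ray_ne_zero hx₁ n)).2
      have hnn : 0 ≤ parityModulated ((((n + 1 : ℕ) : ℤ)) • x₁) * euclidNorm ((((n + 1 : ℕ) : ℤ)) • x₁) ^ (5 - η) :=
        mul_nonneg (parityModulated_nonneg _) (Real.rpow_nonneg hρ0.le _)
      rw [Real.norm_eq_abs, abs_of_nonneg hnn]
      calc parityModulated ((((n + 1 : ℕ) : ℤ)) • x₁) * euclidNorm ((((n + 1 : ℕ) : ℤ)) • x₁) ^ (5 - η)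
          ≤ 3 * euclidNorm ((((n + 1 : ℕ) : ℤ)) • x₁) ^ (-(9 / 2 : ℝ)) * euclidNorm ((((n + 1 : ℕ) : ℤ)) • x₁) ^ (5 - η) :=
            mul_le_mul_of_nonneg_right hb (Real.rpow_nonneg hρ0.le _)
        _ = 3 * euclidNorm ((((n + 1 : ℕ) : ℤ)) • x₁) ^ (-(η - 1 / 2)) := by
            rw [mul_assoc, ← Real.rpow_add hρ0]
            congr 2
            ring
    have := tendsto_nhds_unique h₁ hlim0
    linarith

/-- Packaging: a nonnegative function with two-sided bounds `c|x|₂^{-(5-η₀)} ≤ a ≤ C|x|₂^{-(5-η₀)}`, `η₀ = 1/2 ∈ (0,1)`,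
and no stable tail — so `TAIL` is strictly stronger than the two-sided `TailExponent` statement. -/
theorem twoSided_bounds_not_sufficient :
    ∃ (a : Site 3 → ℝ) (η₀ c C : ℝ), 0 < η₀ ∧ η₀ < 1 ∧ 0 < c ∧
      (∀ x : Site 3, x ≠ 0 → c * euclidNorm x ^ (-(5 - η₀)) ≤ a x ∧ a x ≤ C * euclidNorm x ^ (-(5 - η₀))) ∧
      ¬ HasStableTail a := by
  refine ⟨parityModulated, 1 / 2, 1, 3, by norm_num, by norm_num, one_pos, fun x hx => ?_,
    not_hasStableTail_parityModulated⟩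
  have h := parityModulated_bounds hx
  have e : (-(5 - 1 / 2 : ℝ)) = -(9 / 2 : ℝ) := by norm_num
  rw [e, one_mul]
  exact h


/-! ## §6 Scaling invariance of `H` and `C`; the one pointwise consequence of `H` -/

theorem kernelMatrix_smul (c : ℝ) (G : Site 3 → ℝ) (A : Finset (Site 3)) :
    kernelMatrix (c • G) A = c • kernelMatrix G A := by
  ext p q
  simp [kernelMatrix]

/-- `(c • M)⁻¹ = c⁻¹ • M⁻¹` for `c ≠ 0` and Mathlib's `Matrix.inv` (both sides are `0` when `M` is singular). -/
theorem matrix_inv_smul {ι : Type*} [Fintype ι] [DecidableEq ι] {c : ℝ} (hc : c ≠ 0) (M : Matrix ι ι ℝ) :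
    (c • M)⁻¹ = c⁻¹ • M⁻¹ := by
  by_cases hM : IsUnit M.det
  · refine Matrix.inv_eq_left_inv ?_
    rw [Matrix.smul_mul, Matrix.mul_smul, Matrix.nonsing_inv_mul _ hM, smul_smul, inv_mul_cancel₀ hc, one_smul]
  · have h1 : ¬ IsUnit (c • M).det := by
      rw [Matrix.det_smul]
      intro h
      exact hM (isUnit_of_mul_isUnit_right h)
    rw [Matrix.nonsing_inv_apply_not_isUnit _ hM, Matrix.nonsing_inv_apply_not_isUnit _ h1, smul_zero]

/-- `H` is invariant under positive rescaling of the kernel. -/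
theorem symmPotentialKernel_smul {c : ℝ} (hc : 0 < c) {G : Site 3 → ℝ} (h : SymmPotentialKernel G) :
    SymmPotentialKernel (c • G) := by
  intro A
  obtain ⟨hpd, hZ⟩ := h A
  rw [kernelMatrix_smul, matrix_inv_smul hc.ne']
  refine ⟨hpd.smul hc, fun u v => ⟨fun huv => ?_, ?_⟩⟩
  · have := (hZ u v).1 huv
    simp only [Matrix.smul_apply, smul_eq_mul]
    exact mul_nonpos_of_nonneg_of_nonpos (inv_pos.2 hc).le this
  · have := (hZ u v).2
    simp only [Matrix.smul_apply, smul_eq_mul, ← Finset.mul_sum]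
    exact mul_nonneg (inv_pos.2 hc).le this

theorem symmPotentialKernel_smul_iff {c : ℝ} (hc : 0 < c) {G : Site 3 → ℝ} :
    SymmPotentialKernel (c • G) ↔ SymmPotentialKernel G := by
  refine ⟨fun h => ?_, symmPotentialKernel_smul hc⟩
  have h2 := symmPotentialKernel_smul (inv_pos.2 hc) h
  rwa [smul_smul, inv_mul_cancel₀ hc.ne', one_smul] at h2

/-- The direct correlation function scales inversely: `a_{cG} = c⁻¹ a_G` (`c > 0`). -/
theorem directCorr_smul {c : ℝ} (hc : 0 < c) (G : Site 3 → ℝ) (x : Site 3) :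
    directCorr (c • G) x = c⁻¹ * directCorr G x := by
  unfold directCorr
  rw [Real.mul_iInf_of_nonneg (inv_pos.2 hc).le]
  refine iInf_congr fun A => ?_
  rw [kernelMatrix_smul, matrix_inv_smul hc.ne']
  simp only [Matrix.smul_apply, smul_eq_mul, mul_neg]

/-- `C` is invariant under positive rescaling of the function. -/
theorem HasStableTail.const_mul {c : ℝ} (hc : 0 < c) {a : Site 3 → ℝ} (h : HasStableTail a) :
    HasStableTail (fun x => c * a x) := by
  obtain ⟨η, Φ, hη0, hη1, hΦc, hΦnn, ⟨u, hu, hΦu⟩, hT⟩ := h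
  refine ⟨η, fun v => c * Φ v, hη0, hη1, hΦc.const_smul c |>.congr (fun v _ => by simp [smul_eq_mul]),
    fun v hv => mul_nonneg hc.le (hΦnn v hv), ⟨u, hu, mul_pos hc hΦu⟩, ?_⟩
  have := hT.const_mul c
  rw [mul_zero] at this
  refine this.congr fun x => ?_
  ring

theorem hasStableTail_const_mul_iff {c : ℝ} (hc : 0 < c) {a : Site 3 → ℝ} :
    HasStableTail (fun x => c * a x) ↔ HasStableTail a := by
  refine ⟨fun h => ?_, HasStableTail.const_mul hc⟩
  have h2 := h.const_mul (inv_pos.2 hc)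
  simp only [← mul_assoc, inv_mul_cancel₀ hc.ne', one_mul] at h2
  exact h2

theorem hasStableTail_directCorr_smul_iff {c : ℝ} (hc : 0 < c) {G : Site 3 → ℝ} :
    HasStableTail (directCorr (c • G)) ↔ HasStableTail (directCorr G) := by
  have h : directCorr (c • G) = fun x => c⁻¹ * directCorr G x := funext fun x => directCorr_smul hc G x
  rw [h]
  exact hasStableTail_const_mul_iff (inv_pos.2 hc)

/-- **The schema is scale invariant**: `CruxSchema (cG) ↔ CruxSchema G` for `c > 0`.  Hence the normalisation
`criticalTwoPoint 3 0 = 1` (`criticalTwoPoint_zero'`) and the bound `criticalTwoPoint 3 ≤ 1` carry no information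
for the crux, and the witnesses of §2–§3 may be rescaled at will (e.g. `G₀/G₀(0)` has `G(0) = 1`, `0 < G < 1` off `0`). -/
theorem cruxSchema_smul_iff {c : ℝ} (hc : 0 < c) {G : Site 3 → ℝ} : CruxSchema (c • G) ↔ CruxSchema G := by
  unfold CruxSchema
  rw [symmPotentialKernel_smul_iff hc, hasStableTail_directCorr_smul_iff hc]

/-- **What `H` says pointwise**: positive definiteness of the `2 × 2` blocks `G_{{0,x}}` alone gives
`|G x| < G 0` for `x ≠ 0` when `G` is even (test vectors `e₀ ± e_x`).  For the critical kernel this is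
`⟨σ₀σ_x⟩ < 1`, i.e. nothing beyond the absence of perfect correlation; we found no further pointwise consequence
of `H` on `G` itself (its content is on `G⁻¹`). -/
theorem SymmPotentialKernel.abs_lt_apply_zero {G : Site 3 → ℝ} (h : SymmPotentialKernel G)
    (heven : ∀ x, G (-x) = G x) {x : Site 3} (hx : x ≠ 0) : |G x| < G 0 := by
  let A : Finset (Site 3) := {0, x}
  have h0A : (0 : Site 3) ∈ A := by simp [A]
  have hxA : x ∈ A := by simp [A]
  have hpd := (h A).1
  rw [Matrix.posDef_iff_dotProduct_mulVec] at hpd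
  -- quadratic form of `G_A` on the test vector `w` restricted to `A`
  have hq : ∀ s : ℝ, (s = 1 ∨ s = -1) →
      0 < 2 * G 0 + 2 * s * G x := by
    intro s hs
    let w : Site 3 → ℝ := fun y => if y = 0 then 1 else s
    let v : A → ℝ := fun p => w p.1
    have hv : v ≠ 0 := by
      intro hv
      have := congrFun hv ⟨0, h0A⟩
      simp [v, w] at this
    have hpos := hpd.2 hv
    rw [star_trivial] at hpos
    have hform : v ⬝ᵥ (kernelMatrix G A *ᵥ v) = ∑ p ∈ A, w p * ∑ q ∈ A, G (q - p) * w q := by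
      simp only [dotProduct, Matrix.mulVec, Matrix.of_apply, kernelMatrix, v]
      rw [← Finset.sum_coe_sort A]
      refine Finset.sum_congr rfl fun p _ => ?_
      rw [← Finset.sum_coe_sort A]
    rw [hform] at hpos
    have hx0 : (0 : Site 3) ∉ ({x} : Finset (Site 3)) := by simp [Ne.symm hx]
    simp only [A, Finset.sum_insert hx0, Finset.sum_singleton, w, if_neg hx, sub_zero, sub_self,
      zero_sub, neg_zero, ite_true, one_mul, mul_one] at hpos
    have hs2 : s * s = 1 := by rcases hs with rfl | rfl <;> norm_num
    have e : s * (G (-x) + G 0 * s) = s * G x + G 0 * (s * s) := by rw [heven x]; ring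
    rw [e, hs2] at hpos
    linarith
  have h1 := hq 1 (Or.inl rfl)
  have h2 := hq (-1) (Or.inr rfl)
  rw [abs_lt]
  constructor <;> linarith

/-- Under `H` every term of the infimum defining `a(x)`, `x ≠ 0`, is nonnegative … -/
theorem SymmPotentialKernel.term_nonneg {G : Site 3 → ℝ} (h : SymmPotentialKernel G) {x : Site 3} (hx : x ≠ 0)
    (A : {A : Finset (Site 3) // (0 : Site 3) ∈ A ∧ x ∈ A}) :
    0 ≤ -((kernelMatrix G A.1)⁻¹ ⟨0, A.2.1⟩ ⟨x, A.2.2⟩) :=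
  neg_nonneg.2 (((h A.1).2 _ _).1 fun e => hx (Subtype.ext_iff.mp e).symm)

/-- … so `a(x) ≥ 0` off the origin (the positivity half of "the precision operator is a Laplacian"), … -/
theorem SymmPotentialKernel.directCorr_nonneg {G : Site 3 → ℝ} (h : SymmPotentialKernel G) {x : Site 3}
    (hx : x ≠ 0) : 0 ≤ directCorr G x := by
  haveI : Nonempty {A : Finset (Site 3) // (0 : Site 3) ∈ A ∧ x ∈ A} := ⟨⟨{0, x}, by simp, by simp⟩⟩
  exact le_ciInf (h.term_nonneg hx)

/-- … and `a(x)` is below every finite-volume approximant `-(G_A)⁻¹(0,x)` (the `Real.iInf` is a genuine infimum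
under `H`; with DMS (2.6) it is the monotone limit along `A ↑ ℤ³`, not proved here). -/
theorem SymmPotentialKernel.directCorr_le {G : Site 3 → ℝ} (h : SymmPotentialKernel G) {x : Site 3} (hx : x ≠ 0)
    {A : Finset (Site 3)} (h0 : (0 : Site 3) ∈ A) (hxA : x ∈ A) :
    directCorr G x ≤ -((kernelMatrix G A)⁻¹ ⟨0, h0⟩ ⟨x, hxA⟩) :=
  ciInf_le ⟨0, by rintro _ ⟨B, rfl⟩; exact h.term_nonneg hx B⟩
    (⟨A, h0, hxA⟩ : {A : Finset (Site 3) // (0 : Site 3) ∈ A ∧ x ∈ A})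

/-- In particular `a(x) ≤ G(x)/(G(0)² - G(x)²)` from the block `A = {0, x}` — the two-point (Ornstein–Zernike
first-iterate) upper bound; with the envelope this gives only `a(x) ≤ C‖x‖⁻¹`, far from the `|x|^{-(5-η)}` that
`C` asserts: the decay of `a` is entirely a cancellation phenomenon inside `G⁻¹`. -/
theorem SymmPotentialKernel.directCorr_le_pair {G : Site 3 → ℝ} (h : SymmPotentialKernel G) {x : Site 3}
    (hx : x ≠ 0) :
    directCorr G x ≤ -((kernelMatrix G {0, x})⁻¹ ⟨0, by simp⟩ ⟨x, by simp⟩) :=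
  h.directCorr_le hx _ _

/-! ## §7 Why the crux resists; near-misses (on paper)

1. **No Lean kill is possible through the front door.**  `¬(H → C)` at `G = criticalTwoPoint 3` requires `H`, the
   infinite-volume inverse-M property of the critical kernel — the conclusion of the open items 4798 (`IM`) and 4802;
   and it requires `¬C`, i.e. certified information on the tail of the infinite-volume precision row of the critical
   3-D Ising model.  The tree knows about `criticalTwoPoint 3` exactly `IsingEnvelope` (§3) plus the normalisation
   `G 0 = 1`, `G ≤ 1` (irrelevant by §6) and the local Simon–Lieb inequality `G(z) ≤ tanh β_c · Σ_{|e|=1} G(z+e)`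
   (`criticalTwoPoint_le_tanh_mul_sum_nbrs`), which the Green kernel also satisfies (`localSimonLieb_halfGreen`:
   harmonicity off `0` with weights `1/6`, and `6 tanh β_c(3) ≥ 1` is the tree theorem
   `one_le_two_mul_mul_tanh_criticalBeta`), plus the Messager–Miracle-Solé monotonicities of `twoPointFree`
   (`twoPointFree_add_single_le`, `twoPointFree_le_of_mul_supNorm_le`), true for `G₀` as well (reflection
   positivity of the free field; axis-monotonicity and Turán log-concavity of `n ↦ I_n(t)`) though not formalised
   for `latticeGreen`.  So `G₀` passes every rigorous test in the tree (the MMS ones on paper) and fails `C`: the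
   crux is exactly as hard as "`η(3) > 0` with pointwise regular variation of `G⁻¹(0,·)`"; in particular MMS-type
   monotonicity of `G` cannot be the missing input.
2. **The conformal picture predicts `C`, with a tiny amplitude.**  If `Ĝ(k) = A|k|^{-2+η}(1 + O(|k|^ω))` near `0`
   (`η ≈ 0.0363`, `ω ≈ 0.83`) then `1/Ĝ = A⁻¹|k|^{2-η}(1 + O(|k|^ω))` and, `|k|^{2-η}` being a Lévy–Khintchine
   symbol, `a(x) = -F⁻¹[1/Ĝ](x) = Φ|x|^{-(5-η)}(1 + O(|x|^{-ω}))` with the ISOTROPIC constant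
   `Φ = A⁻¹ 2^{2-η} Γ((5-η)/2) / (π^{3/2} |Γ(-(2-η)/2)|) > 0`, which vanishes linearly as `η → 0⁺`
   (`|k|²` is a polynomial: its transform is supported at the origin).  Numerically `Φ/A⁻¹ ≈ 0.02`: the `|x|^{-4.96}`
   tail of `a` hides under the `O(|x|^{-5.8})` corrections out to `|x|` of order `10²`, so NO finite computation
   (exact tori `≤ 4×4×L`, tubes `ℤ×(ℤ/4)²` of kit j005306, Monte-Carlo inversion) can confirm or refute `TAIL`; the
   2-D control (kit j005353, `η = 1/4`, diagonal line trace) does see the predicted exponent `7/4` and amplitude.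
3. **NEAR-MISS (refuted strengthening, on paper): the converse-Tauberian schema is false.**  One might hope to get
   `C` from `H` plus the isotropic pure power law of `G` itself (item 0634's conclusion `G(x)|x|^{1+η} → c`).  No:
   take the symmetric random walk on `ℤ³` with step law `q(x) ∝ |x|^{-(5-η)}(2 + (-1)^{x₀})`, `0 < η < 1/2`.  Its
   Green kernel `G_q` is a symmetric potential (`H`; potential theory of transient reversible chains, DMS ch. 2),
   lies in `IsingEnvelope` after rescaling, and satisfies `G_q(x)|x|^{1+η} → c > 0` ISOTROPICALLY (the parity
   modulation averages out in the Lévy measure: `q` is in the normal domain of attraction of the rotation-invariant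
   `(2-η)`-stable law; Williamson 1968, Pacific J. Math. 25, Thm. p. 393, window `3/2 < α = 2-η < 2`; Berger 2019
   for the strong renewal version), while its direct correlation function `a = A₀ q` is `parityModulated` up to the
   exponent and has NO stable tail (§5).  Not formalised: the tree has the potential theory of the nearest-neighbour
   walk only (`LatticeGreenPotential`), not of long-range walks.  MORAL: `TAIL` is pointwise regular variation of
   `G⁻¹(0,·)`; it cannot be reached from asymptotics of `G` by any Abelian/Tauberian passage without an a-priori
   regularity (monotonicity / complete monotonicity) input on `a` — which is what the crux-idea cards
   `stieltjes-inversion-cm-direct-correlation` and `self-energy-pick-inversion` try to supply from reflection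
   positivity.  Note that RP plausibly EXCLUDES the sublattice oscillation used here (transverse slab modes
   `â_n(k_⊥) ≥ 0` for `n ≥ 2` would fail at `k_⊥ = (π,π)` for a bipartite modulation), but not a log-periodic
   modulation `2 + sin(log|x|)`, which defeats `C` along every ray in the same way (card
   `rp-cannot-fix-the-scale-log-periodic`).
4. **Dichotomy under `H` (for the planners).**  Under `H`, `a ≥ 0` and `G = A₀⁻¹ Σ_n (a/A₀)^{*n}`.  Either
   `Σ_x a(x)|x|² < ∞` — then the local limit theorem gives `G(x)|x| → c > 0` (Spitzer P26.1; `η = 0`, item 0634 holds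
   with `Δ = 1/2` and `C` FAILS by `not_hasStableTail_of_abs_le_rpow_neg_five`-type reasoning whenever `a` has a
   `|x|^{-5-ε}` envelope) — or `Σ_x a(x)|x|² = ∞`, the only branch in which `C` can hold.  `C` thus silently contains
   the bet `η(3) > 0`; a proof of the crux proves `η(3) > 0`.
5. **Literature (negative search).**  Rigorous Ornstein–Zernike theory exists only off criticality
   (Campanino–Ioffe–Velenik 2003, `β < β_c`; Ott 2020, Aoun–Ott–Velenik 2024 — the grounder's and retriage
   planners' zbMATH searches on the item), and at `β_c` the relation `c(r) ~ r^{-(d+2-η)}` is the physics heuristic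
   of Fisher (J. Math. Phys. 5 (1964) 944; the grounder's note) with the series analyses of Fisher–Burford (Phys. Rev.
   156 (1967) 583) and Stell's critique of closure-based direct correlation functions below `d = 4` (1968–69) —
   CITED FROM MEMORY in this revision: `lit search` / `lit galaxy search` were unavailable (searchd / galaxyd rc 75,
   2026-08-15 23:05–23:40Z), so these three references are unverified here and carry no page quotes.  No printed
   counterexample or theorem bearing on `C` for the Ising model is known to any seat on this item (grounder g13-33,
   rreview c9f4b86e, retriage notes); `ledger negatives` for the summit lists nothing on `G⁻¹`.
6. **Pending numerics (this seat, kit jobs queued 2026-08-15T23:3xZ, results to be folded in here):** j007161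
   (SW Monte Carlo, improved estimator, `a = -F⁻¹[1/Ĝ]` on the `32³` torus at `β_c`: sign census of the precision
   row, short-range profile, radial shell sums, conservativity defect `1/χ_L`), j007164 (`16³` companion),
   j007163 (2-D control on the `128²` torus, where `η = 1/4` is known and `TAIL` predicts `a ~ Φ|x|^{-3.75}`,
   isotropic, positive — the one place the tail dictionary can be seen in full, beyond the diagonal trace of
   j005353).
-/

/-- NEAR-MISS §7.3 as a statement (NOT proved here; true on paper by the long-range-walk witness described above,
whose potential theory is not in the tree): `H` + Ising envelope + isotropic pure power law of `G` do not imply `C`. -/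
def ConverseTauberianSchema : Prop :=
  ∀ G : Site 3 → ℝ, IsingEnvelope G → SymmPotentialKernel G →
    (∃ η c : ℝ, 0 < η ∧ η < 1 ∧ 0 < c ∧ Tendsto (fun x : Site 3 => G x * euclidNorm x ^ (1 + η)) cofinite (𝓝 c)) →
      HasStableTail (directCorr G)

/-- What IS formal about §7.3: the conclusion of `ConverseTauberianSchema` fails for the parity-modulated direct
correlation function of §5 regardless of any hypothesis on `G` — the open part is only the construction of a kernel
`G` realising it (long-range potential theory + Williamson's renewal theorem). -/
theorem converseTauberian_target_fails : ¬ HasStableTail parityModulated := not_hasStableTail_parityModulated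

end Summit.CriticalPhenomena.Ising3DConformalLimit.Cruxes.DirectCorrelationStableTail.Disproof

end
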